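import Mathlib
import Summits.KontsevichZagierPeriods.Zeta5Search.Elimination.HalfShiftMeet
import HarnessLib

/-!
# ζ(5) search — class `elim`: THE HALF-SHIFT RAISE `pr·D(Hz) ∈ ⟨D(z), D(z+e₇), D(z+2e₇)⟩`, CORE IDENTITY
# (E-L19b, part 1 of 2; cell `pub-zeta5`, fam-elim gen 23; second half of gen-1's E-L19 ask of 2026-08-21)

HONEST FRAMING: systematic search; no irrationality claim unless certified.

OUR work (Summit side; `families/elim/FAMILY.md` §6 (E-L19b)).  After the meet `Π(z) ∩ Π(Hz)` (`dictMeet_at`,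
`HalfShiftMeet`), ONE more explicit relation pins the half-shifted coefficient vectors `D(Hz), D(Hz + e₇)` against the
slot-7 line `D(z), D(z + e₇), D(z + 2e₇)` (a basis of `ℚ³` wherever `cas3(z) ≠ 0`): RAISE3,
   `pr·D(Hz) = Θ₁·D(z) + Θ₂·D(z + e₇) + Θ₃·D(z + 2e₇)`,
   `pr = ∏_{j<k ∈ {1,2,3,6}} (z₀ + 1 − z_j − z_k)`,  `Θ₁ = A·q(−z₇ − 1)`,  `Θ₃ = d·Q`  (`A = meetA`, `Q = meetQ`,
   `d = 3z₀ − Σ_j z_j`),  `Θ₂` an explicit 58-term form (`th2Form`),  `q(t) = q₂t² + q₁t + q₀` the telescoper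
   quadratic: `q₂ = e₁ − 2M`, `q₁ = (e₁ − M)(e₁ − 2M)`, `q₀ = (e₁ − M)e₂ − e₃ − M(e₁ − M)²`
   (`M = z₀ + 1`, `eₖ` the elementary symmetric functions of `u_j = M − z_j`, `j ∈ {1,2,3,6}`).
This file: the closed forms and the CORE IDENTITY `raise_core` (the analogue of `meet_core`): a polynomial identity
in `x, z₀, …, z₇`.  Expanded in the nine slot variables it has ≈ 1.2·10⁵ monomials (fam-elim g23 `e19/probe41.out`:
124 257 — too many for one `ring` call on the farm), but the non-raised slots `z₁, z₂, z₃, z₆` enter only through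
`∏_{j∉T}(x + u_j) = x⁴ + e₁x³ + e₂x² + e₃x + e₄`, `∏_{j∉T}(x + z_j)`, `pr` (a 16-monomial form in `M, e₁, …, e₄`,
`prForm`) and the `eₖ` in `q, Θ₂, Q, d`: in the free variables `x, M, e₁, e₂, e₃, e₄, z₄, z₅, z₇` the same identity
has 9 505 monomials (`raise_coreE`, one `ring`), and `raise_core` is its specialisation.
Provenance: generic creative-telescoping solver + tensor interpolation, fam-elim g23 `e19/probe32–39` (`Θ₂`: 313
monomials in the slots, 58 in the symmetric coordinates; telescoper quadratic 10/10; RAISE3 == the actual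
partial-fraction relation incl. `V` at 8/8 points, `probe36`); the x-frame identity with closed forms only held at
30/30 random rational points (`probe40`) and expands to zero exactly (`probe41`) before formalisation.
Part 2 (`HalfShiftRaise`): the `1 + 3` mixed-level summability principle, the telescoper and `dictRaise_at`.
What this is NOT: anything about sizes, denominators, valuations or irrationality; the class verdict is unchanged
(T1 NO / T2 NO / T4 YES).
-/

open Finset Polynomial

namespace Summit.KontsevichZagierPeriods.Zeta5Search.Elimination

open Summit.KontsevichZagierPeriods.Zeta5Search.WedgeDictionary

/-! ### Symmetric coordinates: `M = z₀ + 1`, `u_j = M − z_j` (`j ∈ {1,2,3,6}`), `e_k = e_k(u₁,u₂,u₃,u₆)` -/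

/-- `M = z₀ + 1`. -/
def raiseM (z : ℕ → ℤ) : ℚ := (z 0 : ℚ) + 1

/-- `u_j = z₀ + 1 − z_j`. -/
def uOf (z : ℕ → ℤ) (j : ℕ) : ℚ := (z 0 : ℚ) + 1 - z j

/-- `e₁(u₁,u₂,u₃,u₆)`. -/
def raiseE1 (z : ℕ → ℤ) : ℚ := uOf z 1 + uOf z 2 + uOf z 3 + uOf z 6

/-- `e₂(u₁,u₂,u₃,u₆)`. -/
def raiseE2 (z : ℕ → ℤ) : ℚ :=
  uOf z 1 * uOf z 2 + uOf z 1 * uOf z 3 + uOf z 1 * uOf z 6 + uOf z 2 * uOf z 3 + uOf z 2 * uOf z 6 + uOf z 3 * uOf z 6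

/-- `e₃(u₁,u₂,u₃,u₆)`. -/
def raiseE3 (z : ℕ → ℤ) : ℚ :=
  uOf z 1 * uOf z 2 * uOf z 3 + uOf z 1 * uOf z 2 * uOf z 6 + uOf z 1 * uOf z 3 * uOf z 6 + uOf z 2 * uOf z 3 * uOf z 6

/-- `e₄(u₁,u₂,u₃,u₆)`. -/
def raiseE4 (z : ℕ → ℤ) : ℚ := uOf z 1 * uOf z 2 * uOf z 3 * uOf z 6

/-! ### The closed forms as forms in `(M, e₁, e₂, e₃, e₄; z₄, z₅, z₇)` -/

/-- The telescoper quadratic `q(t) = q₂t² + q₁t + q₀`: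
`q₂ = e₁ − 2M`, `q₁ = (e₁ − M)(e₁ − 2M)`, `q₀ = (e₁ − M)e₂ − e₃ − M(e₁ − M)²`. -/
def qForm (M e1 e2 e3 t : ℚ) : ℚ :=
  (e1 - 2 * M) * t ^ 2 + (e1 - M) * (e1 - 2 * M) * t + ((e1 - M) * e2 - e3 - M * (e1 - M) ^ 2)

/-- `A = (M − 2 − z₄ − z₅ − z₇)(z₇ + 1)(M − z₇) + (z₄ + 1)(z₅ + 1)(z₇ + 1)` (`= meetA`). -/
def aForm (M z4 z5 z7 : ℚ) : ℚ := (M - 2 - z4 - z5 - z7) * (z7 + 1) * (M - z7) + (z4 + 1) * (z5 + 1) * (z7 + 1)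

/-- The coefficient `Θ₂` (58 terms; `w = z₇`, `s₁ = z₄ + z₅`, `s₂ = z₄z₅`). -/
def th2Form (M e1 e2 e3 w s1 s2 : ℚ) : ℚ :=
  (10 * e1 - 20 * M - 5 * e1 ^ 2 + 9 * M * e1 + 2 * M ^ 2 - 2 * e3 + 2 * e1 * e2 - 2 * M * e2 + M * e1 ^ 2 - 5 *
    M ^ 2 * e1 + 4 * M ^ 3 + M * e3 - M * e1 * e2 + M ^ 2 * e2 + M ^ 2 * e1 ^ 2 - 2 * M ^ 3 * e1 + M ^ 4 + s1 *
    (5 * e1 - 10 * M - 2 * e1 ^ 2 + 5 * M * e1 - 2 * M ^ 2 - e3 + e1 * e2 - M * e2 - M * e1 ^ 2 + 2 * M ^ 2 * e1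
    - M ^ 3) + s2 * (2 * e1 - 4 * M - e1 ^ 2 + 4 * M * e1 - 4 * M ^ 2) + w * (17 * e1 - 34 * M - 6 * e1 ^ 2 + 11
    * M * e1 + 2 * M ^ 2 - e3 + e1 * e2 - M * e2 + M * e1 ^ 2 - 4 * M ^ 2 * e1 + 3 * M ^ 3) + w * s1 * (6 * e1 -
    12 * M - e1 ^ 2 + 2 * M * e1) + w * s2 * (e1 - 2 * M) + w * w * (10 * e1 - 20 * M - 2 * e1 ^ 2 + 4 * M * e1)
    + w * w * s1 * (2 * e1 - 4 * M) + w ^ 3 * (2 * e1 - 4 * M))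

/-- `pr = ∏_{j<k ∈ {1,2,3,6}} (u_j + u_k − M)` expanded in the `e_k` (16 monomials). -/
def prForm (M e1 e2 e3 e4 : ℚ) : ℚ :=
  -e3 ^ 2 + e1 * e2 * e3 - e1 ^ 2 * e4 + 4 * M * e1 * e4 - M * e1 * e2 ^ 2 - M * e1 ^ 2 * e3 - 4 * M ^ 2 * e4
    + M ^ 2 * e2 ^ 2 + M ^ 2 * e1 * e3 + 2 * M ^ 2 * e1 ^ 2 * e2 - 4 * M ^ 3 * e1 * e2 - M ^ 3 * e1 ^ 3
    + 2 * M ^ 4 * e2 + 3 * M ^ 4 * e1 ^ 2 - 3 * M ^ 5 * e1 + M ^ 6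

/-- `∏_{j ∉ T}(x + u_j) = x⁴ + e₁x³ + e₂x² + e₃x + e₄` (`= pcStar`). -/
def pcForm (x e1 e2 e3 e4 : ℚ) : ℚ := x ^ 4 + e1 * x ^ 3 + e2 * x ^ 2 + e3 * x + e4

/-- `∏_{j ∉ T}(x + z_j) = (x+M)⁴ − e₁(x+M)³ + e₂(x+M)² − e₃(x+M) + e₄`. -/
def zcForm (x M e1 e2 e3 e4 : ℚ) : ℚ := (x + M) ^ 4 - e1 * (x + M) ^ 3 + e2 * (x + M) ^ 2 - e3 * (x + M) + e4

set_option maxHeartbeats 800000 in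
/-- **The core identity of RAISE3, symmetric form** (a polynomial identity in the free variables
`x, M, e₁, e₂, e₃, e₄, z₄, z₅, z₇`; found by exact rational interpolation, fam-elim g23 `e19/probe32–41`). -/
theorem raise_coreE (x M e1 e2 e3 e4 z4 z5 z7 : ℚ) :
    aForm M z4 z5 z7 * qForm M e1 e2 e3 (-(z7 + 1)) * (2 * x + (M - 1)) * pcForm x e1 e2 e3 e4
      + th2Form M e1 e2 e3 z7 (z4 + z5) (z4 * z5) * ((x + z7) * (x + (M - 1 - z7))) * (2 * x + (M - 1)) *
          pcForm x e1 e2 e3 e4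
      + (e1 - M - 3 - z4 - z5 - z7) * (-(e1 - 2 * M)) * ((x + z7) * (x + (M - 1 - z7))) *
          ((x + (z7 + 1)) * (x + (M - 1 - z7 - 1))) * (2 * x + (M - 1)) * pcForm x e1 e2 e3 e4
      - prForm M e1 e2 e3 e4 * (2 * x + (M - 1) + 1) * (x + (M - 1) + 1) * ((x + z4) * (x + z5) * (x + z7))
      - (qForm M e1 e2 e3 x * (x + (M - 1) + 1) * (zcForm x M e1 e2 e3 e4 * ((x + z4) * (x + z5) * (x + z7)))
          - (x - 1) * qForm M e1 e2 e3 (x - 1) * ((x + (M - 1 - z4)) * (x + (M - 1 - z5)) * (x + (M - 1 - z7))) *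
              pcForm x e1 e2 e3 e4) = 0 := by
  unfold aForm qForm th2Form prForm pcForm zcForm
  ring

/-! ### The closed forms at an integer point `z` -/

/-- `q_z(t)`. -/
def raiseQ (z : ℕ → ℤ) (t : ℚ) : ℚ := qForm (raiseM z) (raiseE1 z) (raiseE2 z) (raiseE3 z) t

/-- `Θ₁ = A·q(−(z₇ + 1))`. -/
def raiseTh1 (z : ℕ → ℤ) : ℚ := meetA z * raiseQ z (-((z 7 : ℚ) + 1))

/-- `Θ₂`. -/
def raiseTh2 (z : ℕ → ℤ) : ℚ :=
  th2Form (raiseM z) (raiseE1 z) (raiseE2 z) (raiseE3 z) (z 7) ((z 4 : ℚ) + z 5) ((z 4 : ℚ) * z 5)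

/-- `d = 3z₀ − Σ_j z_j` as a rational number (`= dOf z`, `raiseD_eq`). -/
def raiseD (z : ℕ → ℤ) : ℚ := 3 * (z 0 : ℚ) - z 1 - z 2 - z 3 - z 4 - z 5 - z 6 - z 7

/-- `Θ₃ = d·Q`. -/
def raiseTh3 (z : ℕ → ℤ) : ℚ := raiseD z * meetQ z

/-- `pr = ∏_{j<k ∈ {1,2,3,6}} (z₀ + 1 − z_j − z_k)`. -/
def raisePr (z : ℕ → ℤ) : ℚ :=
  ((z 0 : ℚ) + 1 - z 1 - z 2) * ((z 0 : ℚ) + 1 - z 1 - z 3) * ((z 0 : ℚ) + 1 - z 1 - z 6) *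
    ((z 0 : ℚ) + 1 - z 2 - z 3) * ((z 0 : ℚ) + 1 - z 2 - z 6) * ((z 0 : ℚ) + 1 - z 3 - z 6)

/-- `raiseD z = d(z)`. -/
theorem raiseD_eq (z : ℕ → ℤ) : raiseD z = (dOf z : ℚ) := by
  unfold raiseD dOf
  simp only [sum_range_succ, sum_range_zero]
  push_cast
  ring

set_option maxHeartbeats 800000 in
/-- **The core identity of RAISE3** at an integer point (the frame of `meet_core`: `Pc*`, `PT*`, `∏(x+z_j)`, `T₃`). -/
theorem raise_core (z : ℕ → ℤ) (x : ℚ) :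
    raiseTh1 z * (2 * x + z 0) * pcStar z x
      + raiseTh2 z * ((x + z 7) * (x + (z 0 - z 7))) * (2 * x + z 0) * pcStar z x
      + raiseTh3 z * ((x + z 7) * (x + (z 0 - z 7))) * ((x + (z 7 + 1)) * (x + (z 0 - z 7 - 1))) * (2 * x + z 0) *
          pcStar z x
      - raisePr z * (2 * x + z 0 + 1) * (x + z 0 + 1) * ptStar z x
      - (raiseQ z x * (x + z 0 + 1) * zAll z x - (x - 1) * raiseQ z (x - 1) * t3Eval z x * pcStar z x) = 0 := by
  have h := raise_coreE x (raiseM z) (raiseE1 z) (raiseE2 z) (raiseE3 z) (raiseE4 z) (z 4) (z 5) (z 7)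
  have hPc : pcStar z x = pcForm x (raiseE1 z) (raiseE2 z) (raiseE3 z) (raiseE4 z) := by
    unfold pcStar pcForm raiseE1 raiseE2 raiseE3 raiseE4 uOf; ring
  have hzAll : zAll z x =
      zcForm x (raiseM z) (raiseE1 z) (raiseE2 z) (raiseE3 z) (raiseE4 z) * ((x + z 4) * (x + z 5) * (x + z 7)) := by
    unfold zAll zcForm raiseM raiseE1 raiseE2 raiseE3 raiseE4 uOf; ring
  have hpr : raisePr z = prForm (raiseM z) (raiseE1 z) (raiseE2 z) (raiseE3 z) (raiseE4 z) := by
    unfold raisePr prForm raiseM raiseE1 raiseE2 raiseE3 raiseE4 uOf; ring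
  have ht3 : t3Eval z x = (x + (raiseM z - 1 - z 4)) * (x + (raiseM z - 1 - z 5)) * (x + (raiseM z - 1 - z 7)) := by
    unfold t3Eval raiseM; ring
  have hpt : ptStar z x = (x + z 4) * (x + z 5) * (x + z 7) := rfl
  have hA : meetA z = aForm (raiseM z) (z 4) (z 5) (z 7) := by unfold meetA meetD0 aForm raiseM; ring
  have hQ : meetQ z = -(raiseE1 z - 2 * raiseM z) := by unfold meetQ raiseE1 raiseM uOf; ring
  have hD : raiseD z = raiseE1 z - raiseM z - 3 - z 4 - z 5 - z 7 := by unfold raiseD raiseE1 raiseM uOf; ring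
  have hz0 : (z 0 : ℚ) = raiseM z - 1 := by unfold raiseM; ring
  unfold raiseTh1 raiseTh2 raiseTh3 raiseQ
  rw [hPc, hzAll, hpr, ht3, hpt, hA, hQ, hD, hz0]
  unfold aForm qForm th2Form prForm pcForm zcForm at h ⊢
  linear_combination h

end Summit.KontsevichZagierPeriods.Zeta5Search.Elimination
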